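import Literature.AlgebraicGeometry.ShimuraVarieties.UnitaryShimuraCurveLevelQuotient
import Literature.AlgebraicGeometry.ShimuraVarieties.UnitaryCurveSiegelPointSeparation
import Literature.AlgebraicGeometry.ShimuraVarieties.UnitaryCurveSiegelInjectiveDescent
import Literature.AlgebraicGeometry.ModuliOfAbelianVarieties.SiegelPrincipalLevelNormal
import Literature.AlgebraicGeometry.ModuliOfAbelianVarieties.SiegelShimuraSetLevelChange
import Literature.AlgebraicGeometry.Motives.ComplexPointsImageStationarity
import HarnessLib

/-!
# Deligne's Prop. 1.15 at PRINCIPAL level for the unitary Shimura curve: one deep Siegel level already classifies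

Topic `AlgebraicGeometry/ShimuraVarieties`; namespace `Literature.AlgebraicGeometry.ShimuraVarieties.UnitaryCurve` (+ one bookkeeping lemma on
Siegel classes in `Literature.AlgebraicGeometry.ModuliOfAbelianVarieties`).  THEOREMS ONLY (no `def`, no named fact, no instance, no `sorry`).
Cell `hodgecm-mathlib`, crux HLiu418 (stmt-HodgeConjecture-24832), sub-line P6a, E-line `F0_P6a_PELWitnessE`, organ «DELIGNE 1.15 AT PRINCIPAL
LEVEL» (LEAD F0P6-plan (g3) «M-52», 2026-09-02T00:57Z), part (A) «STATIONARITY» assembled with part (B) (★ `UnitaryCurveSiegelInjectiveDescent`)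
and ★ FILE B (`UnitaryCurveSiegelPointSeparation`): the rank-2, cone-coordinate twin of the HDel assembly ★ `F1ExtHodgeTypeStubS2inj`.

THE SETTING.  A record system `S` of the unitary Shimura curve `Sh(U(J⋆), 𝔻)` (★ `RecordSystemGS`: models `S.M K`, points `S.pts`, transitions
`map_pts`, `projective`), the Hodge-embedding datum `(J, hJ, b, bq)` of ★ FILES A–C with its laws `hJsmul hb hJrat hJinj hbrat hbcont` (= the
`AuxChartGS` fields of the E-line), a small level `K ≤ b⁻¹K_δ(N₀)` with `N₀ ≥ 3`, the FACTORIAL TOWER of saturated sublevels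
`K_k := K ⊓ b⁻¹K_δ(N₀·(k+1)!)` (given as small levels `Kt k` with that underlying subgroup — open and compact by `isOpen∕isCompact_inf_comap_principalLevelSubgroup`),
and, for every `k`, ANY morphism of `ℂ`-schemes `f_k : (S.M K_k)_ℂ ⟶ A_k` to a SEPARATED target whose fibres on complex points are the level-`N₀(k+1)!`
Siegel classes: `f_k [v, a] = f_k [v′, a′] ↔ [J v, b a]_{K_δ(N₀(k+1)!)} = [J v′, b a′]_{K_δ(N₀(k+1)!)}` (`hf`; in the E-line: E4's GAGA morphism `ψ`
over E3's chart, ★ `RecordSystemGS.exists_hom_of_holomorphicSiegelLifts` + `AuxChartGS.f_pts`).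

WHAT IS PROVED — `exists_forall_le_siegelPointMap_injective` ([Deligne1971TravauxShimura] Prop. 1.15 p. 132, «le graphe de la relation
d'équivalence … décroît avec `K₂`, donc est stationnaire … il suffit de montrer que `u(K₁)` est injectif»): THERE IS `k₀` SUCH THAT FOR EVERY
`k ≥ k₀` (i) `f_k` is INJECTIVE on complex points, (ii) level-`N₀(k+1)!` Siegel equality forces equality in `Sh_{K_k}(ℂ)`, and (iii) it forces
equality in `Sh_K(ℂ)` (separation of `Sh_K` by one deep shadow).  Assembly, all ★ by name:
* the IMAGE relations `R_k = {(π_k P, π_k Q) | f_k P = f_k Q} ⊆ T(ℂ)²`, `T = (S.M K)_ℂ`, `π_k = (S.M.map _)_ℂ` (projective sources and base,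
  ★ `IsProjectiveOver.baseChangeHom_obj`; point formula ★ `RecordSystemGS.map_pts_symm`), are ANTITONE (Siegel level change ★
  `SiegelShimuraSet.mk_eq_mk_of_le`) and `⋂_k R_k ⊆ Δ` by ★ FILE B `gs_mk_eq_of_forall_siegel_mk_eq` (lifts normalised to `[v, a u]`, `u ∈ K`, by ★
  `ShimuraSetGS.mk_eq_mk_iff_exists_mem`; `b(u) ∈ K_δ(1)` moved across by `SiegelShimuraSet.mk_mul_eq_mk_iff_of_mem_one`);
* Noetherian IMAGE-stationarity ★ `Motives.exists_setOf_exists_map_eq_subset_of_iInter_subset` gives `k₀` with `R_{k₀} ⊆ Δ`, hence `R_k ⊆ Δ` for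
  `k ≥ k₀` (antitone) = (iii);
* (ii) and (i) from (iii) by the PAIR LAW ★ `gs_mk_inf_comap_eq_of_gs_mk_eq_of_siegel_mk_eq` (part (B): `Sh_{K ⊓ b⁻¹K_δ(N)} → Sh_K × Sh_{K_δ(N)}` is
  injective, [Deligne 1971] 1.15 «`Γ` sans torsion»).

HC_CM is proved only modulo the 2 remaining named inputs (hLiu418 24832, h413 24833) until rung 0 closes; this file discharges neither (count-neutral
support of 24832: it is the `sep` input of E-line ED. 5 at the `b`-saturated witness levels).

## References
* [Deligne1971TravauxShimura] P. Deligne, *Travaux de Shimura*, Sém. Bourbaki 389 (1971), Prop. 1.15 with its proof and Lemme 1.15.3 p. 132, 1.8 p. 129.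
* [Milne2005ShimuraVarieties] J. S. Milne, *Introduction to Shimura varieties* (2005; rev. 2017), §5 (5.1) p. 56, Lemma 5.13 p. 57, Thm. 5.17 p. 59, Rem. 5.29 (c) p. 65.
* [Deligne1979ShimuraVarieties] P. Deligne, *Variétés de Shimura* (1979), Prop. 2.3.10, 2.1.2–2.1.4.
* [GortzWedhorn2020] U. Görtz, T. Wedhorn, *Algebraic Geometry I* (2nd ed. 2020), §(1.9)–(1.10), §(4.7), Cor. 13.41.
-/

set_option autoImplicit false

noncomputable section

open Function Matrix NumberField IsDedekindDomain CategoryTheory CategoryTheory.Limits AlgebraicGeometry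
open scoped Matrix ComplexOrder
open Literature.AlgebraicGeometry.Motives
open Literature.NumberTheory.Automorphic.UnitaryGroup
open Literature.NumberTheory.Automorphic.Liu2021.AppendixC (C5.OpenCompactSubgroup C5.SmallLevel)

/-! ### §1. Bookkeeping on Siegel classes: moving a normalising element across (level change is ★ `SiegelShimuraSet.mk_eq_mk_of_le`) -/

namespace Literature.AlgebraicGeometry.ModuliOfAbelianVarieties

variable {g : ℕ} {δ : Fin g → ℕ}

/-- **Moving a normalising element across**: for `κ ∈ K_δ(1)` (it normalises every `K_δ(N)`, ★ `principalLevelSubgroup_normal_in_one`),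
`[J, aκ] = [J′, a′]` at level `K_δ(N)` iff `[J, a] = [J′, a′κ⁻¹]` (the Literature home of the Summits-side ★ `siegelShimuraSet_mk_mul_eq_mk_iff` of
`F1ExtHodgeTypeStubS2inj`, which a Literature file cannot import). [cite: Milne2005ShimuraVarieties, §5 (5.1) p. 56, §6 p. 70] -/
theorem SiegelShimuraSet.mk_mul_eq_mk_iff_of_mem_one (N : ℕ) {κ : gspFinAdelic δ} (hκ : κ ∈ principalLevelSubgroup δ 1)
    (J J' : C0pm δ) (a a' : gspFinAdelic δ) :
    SiegelShimuraSet.mk δ (principalLevelSubgroup δ N) J (a * κ) = SiegelShimuraSet.mk δ (principalLevelSubgroup δ N) J' a' ↔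
      SiegelShimuraSet.mk δ (principalLevelSubgroup δ N) J a = SiegelShimuraSet.mk δ (principalLevelSubgroup δ N) J' (a' * κ⁻¹) := by
  rw [SiegelShimuraSet.mk_eq_mk_iff, SiegelShimuraSet.mk_eq_mk_iff]
  refine exists_congr fun γ => and_congr_right fun _ => ?_
  rw [MulAction.Quotient.smul_mk, smul_eq_mul, QuotientGroup.eq, MulAction.Quotient.smul_mk, smul_eq_mul, QuotientGroup.eq]
  set X : gspFinAdelic δ := (gspRationalToFinAdelic δ γ * a')⁻¹ * a with hX
  have h1 : (gspRationalToFinAdelic δ γ * a')⁻¹ * (a * κ) = X * κ := by rw [hX]; group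
  have h2 : (gspRationalToFinAdelic δ γ * (a' * κ⁻¹))⁻¹ * a = κ * X := by rw [hX]; group
  rw [h1, h2]
  constructor
  · intro h
    have := principalLevelSubgroup_normal_in_one δ N hκ h
    have heq : κ * (X * κ) * κ⁻¹ = κ * X := by group
    rwa [heq] at this
  · intro h
    have := principalLevelSubgroup_normal_in_one δ N (inv_mem hκ) h
    have heq : κ⁻¹ * (κ * X) * κ⁻¹⁻¹ = X * κ := by group
    rwa [heq] at this

end Literature.AlgebraicGeometry.ModuliOfAbelianVarieties

namespace Literature.AlgebraicGeometry.ShimuraVarieties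

open Literature.AlgebraicGeometry.ModuliOfAbelianVarieties
open UnitaryCanonicalModel

namespace UnitaryCurve

variable {L : Type} [Field L] [NumberField L] [IsCMField L] {Jstar : Matrix (Fin 2) (Fin 2) L} {τ : L →+* ℂ}
variable {K₀ : C5.OpenCompactSubgroup ↥(finAdelic (↥(maximalRealSubfield L)) L (IsCMField.complexConj L) 2 Jstar)}
variable {g : ℕ} {δ : Fin g → ℕ}
variable (S : RecordSystemGS L Jstar τ K₀)
variable (J : (Fin 2 → ℂ) → Matrix (Fin g ⊕ Fin g) (Fin g ⊕ Fin g) ℝ)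
  (hJ : ∀ v : Fin 2 → ℂ, v ∈ negCone (Jstar.map τ) → J v ∈ C0pm δ)
  (b : ↥(finAdelic (↥(maximalRealSubfield L)) L (IsCMField.complexConj L) 2 Jstar) →* ↥(gspFinAdelic δ))
  (bq : ↥(rational (↥(maximalRealSubfield L)) L (IsCMField.complexConj L) 2 Jstar) →* ↥(gspRational δ))

/-! ### §2. The saturated sublevels `K ⊓ b⁻¹K_δ(N)` are open and compact; naturality of `X(ℂ) ⥲ X_τ(ℂ)` -/

/-- `K ⊓ b⁻¹K_δ(N)` is OPEN for `K` open, `b` continuous and `N ≠ 0` (★ `isOpen_principalLevelSubgroup`). [cite: Deligne1971TravauxShimura, Prop. 1.15 p. 132] -/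
theorem isOpen_inf_comap_principalLevelSubgroup (hbcont : Continuous b) {N : ℕ} (hN : N ≠ 0)
    (K : Subgroup ↥(finAdelic (↥(maximalRealSubfield L)) L (IsCMField.complexConj L) 2 Jstar))
    (hK : IsOpen (K : Set ↥(finAdelic (↥(maximalRealSubfield L)) L (IsCMField.complexConj L) 2 Jstar))) :
    IsOpen ((K ⊓ (principalLevelSubgroup δ N).comap b :
      Subgroup ↥(finAdelic (↥(maximalRealSubfield L)) L (IsCMField.complexConj L) 2 Jstar)) :
        Set ↥(finAdelic (↥(maximalRealSubfield L)) L (IsCMField.complexConj L) 2 Jstar)) := by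
  rw [Subgroup.coe_inf, Subgroup.coe_comap]
  exact hK.inter ((isOpen_principalLevelSubgroup δ hN).preimage hbcont)

/-- `K ⊓ b⁻¹K_δ(N)` is COMPACT for `K` compact, `b` continuous and `N ≠ 0` (★ `isClosed_principalLevelSubgroup`). [cite: Deligne1971TravauxShimura, Prop. 1.15 p. 132] -/
theorem isCompact_inf_comap_principalLevelSubgroup (hbcont : Continuous b) {N : ℕ} (hN : N ≠ 0)
    (K : Subgroup ↥(finAdelic (↥(maximalRealSubfield L)) L (IsCMField.complexConj L) 2 Jstar))
    (hK : IsCompact (K : Set ↥(finAdelic (↥(maximalRealSubfield L)) L (IsCMField.complexConj L) 2 Jstar))) :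
    IsCompact ((K ⊓ (principalLevelSubgroup δ N).comap b :
      Subgroup ↥(finAdelic (↥(maximalRealSubfield L)) L (IsCMField.complexConj L) 2 Jstar)) :
        Set ↥(finAdelic (↥(maximalRealSubfield L)) L (IsCMField.complexConj L) 2 Jstar)) := by
  rw [Subgroup.coe_inf, Subgroup.coe_comap]
  exact hK.inter_right ((isClosed_principalLevelSubgroup δ hN).preimage hbcont)

omit [NumberField L] [IsCMField L] in
/-- Naturality of `X(ℂ) ⥲ X_τ(ℂ)` (`AlgPoints.baseChangeEquiv`) in the `L`-scheme: `(x ≫ f)_τ = x_τ ≫ f_τ`. [cite: GortzWedhorn2020, §(4.7) eq. (4.7.1)] -/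
private theorem map_baseChangeHom_map_baseChangeEquiv {X Y : SchemeOver L} (f : X ⟶ Y) (x : letI := τ.toAlgebra; ComplexPoints X) :
    (letI := τ.toAlgebra
     AlgPoints.map ((baseChangeHom τ).map f) (AlgPoints.baseChangeEquiv τ X x) = AlgPoints.baseChangeEquiv τ Y (AlgPoints.map f x)) := by
  letI : Algebra L ℂ := τ.toAlgebra
  symm
  rw [Equiv.apply_eq_iff_eq_symm_apply]
  apply Over.OverMorphism.ext
  rw [AlgPoints.baseChangeEquiv_symm_apply_left, AlgPoints.map_apply, Over.comp_left, AlgPoints.map_apply, Over.comp_left,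
    Category.assoc, baseChangeHom_map_left_comp_fst, ← Category.assoc, AlgPoints.baseChangeEquiv_apply_left_comp_fst]
  rfl

/-! ### §3. [Deligne 1971] Prop. 1.15 at principal level: one deep Siegel level classifies -/

/-- **DELIGNE'S PROP. 1.15 AT PRINCIPAL LEVEL FOR THE UNITARY SHIMURA CURVE.**  Let `S` be a record system of `Sh(U(J⋆), 𝔻)`, `(J, b, bq)` the
Hodge-embedding datum (`hJ hJsmul hb hJrat hJinj hbrat hbcont`), `K ≤ b⁻¹K_δ(N₀)` a small level with `N₀ ≥ 3`, `K_k := K ⊓ b⁻¹K_δ(N₀(k+1)!)` the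
factorial tower of saturated sublevels (small levels `Kt k`), and for every `k` a morphism `f_k : (S.M K_k)_ℂ ⟶ A_k` to a separated `ℂ`-scheme with
`f_k [v, a] = f_k [v′, a′] ↔ [J v, b a]_{K_δ(N₀(k+1)!)} = [J v′, b a′]_{K_δ(N₀(k+1)!)}` on complex points.  THEN there is `k₀` such that for every
`k ≥ k₀`: (i) `f_k` is INJECTIVE on complex points; (ii) level-`N₀(k+1)!` Siegel equality of `(J v, b a)`, `(J v′, b a′)` forces `[v, a] = [v′, a′]` in
`Sh_{K_k}(ℂ)`; (iii) it forces `[v, aK] = [v′, a′K]` in `Sh_K(ℂ)`.  Proof: antitone IMAGE relations `R_k ⊆ (S.M K)_ℂ(ℂ)²` with `⋂ R_k ⊆ Δ`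
(★ FILE B), Noetherian image-stationarity (★ `exists_setOf_exists_map_eq_subset_of_iInter_subset`), then the pair law (★ part (B)).
[cite: Deligne1971TravauxShimura, Prop. 1.15 with its proof and Lemme 1.15.3 p. 132] [cite: Milne2005ShimuraVarieties, Lemma 5.13 p. 57, Thm. 5.17 p. 59, Rem. 5.29 (c) p. 65]
[cite: Deligne1979ShimuraVarieties, Prop. 2.3.10] -/
theorem exists_forall_le_siegelPointMap_injective
    (hJsmul : ∀ c : ℂ, c ≠ 0 → ∀ v : Fin 2 → ℂ, v ∈ negCone (Jstar.map τ) → J (c • v) = J v)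
    (hb : ∀ γ : ↥(rational (↥(maximalRealSubfield L)) L (IsCMField.complexConj L) 2 Jstar),
      b (rationalToFinAdelic (↥(maximalRealSubfield L)) L (IsCMField.complexConj L) 2 Jstar γ) = gspRationalToFinAdelic δ (bq γ))
    (hJrat : ∀ (γ : ↥(rational (↥(maximalRealSubfield L)) L (IsCMField.complexConj L) 2 Jstar)) (v : Fin 2 → ℂ),
      v ∈ negCone (Jstar.map τ) →
        J (((ratToGLℂ L Jstar τ γ : GL (Fin 2) ℂ) : Matrix (Fin 2) (Fin 2) ℂ) *ᵥ v) =
          conjJ ((gspRationalToReal δ (bq γ) : ↥(gspReal δ)) : GL (Fin g ⊕ Fin g) ℝ) (J v))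
    (hJinj : ∀ v : Fin 2 → ℂ, v ∈ negCone (Jstar.map τ) → ∀ v' : Fin 2 → ℂ, v' ∈ negCone (Jstar.map τ) →
      J v = J v' → ∃ c : ℂ, c ≠ 0 ∧ c • v' = v)
    (hbrat : ∀ (γ : ↥(gspRational δ)) (x : ↥(finAdelic (↥(maximalRealSubfield L)) L (IsCMField.complexConj L) 2 Jstar)),
      gspRationalToFinAdelic δ γ = b x →
        ∃ β : ↥(rational (↥(maximalRealSubfield L)) L (IsCMField.complexConj L) 2 Jstar),
          x = rationalToFinAdelic (↥(maximalRealSubfield L)) L (IsCMField.complexConj L) 2 Jstar β ∧ γ = bq β)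
    (hbcont : Continuous b) {N₀ : ℕ} (hN₀ : 3 ≤ N₀)
    (K : C5.SmallLevel K₀) (hle : K.1.1 ≤ (principalLevelSubgroup δ N₀).comap b)
    (Kt : ℕ → C5.SmallLevel K₀)
    (hKt : ∀ k, (Kt k).1.1 = K.1.1 ⊓ (principalLevelSubgroup δ (N₀ * (k + 1).factorial)).comap b)
    {A : ℕ → SchemeOver ℂ} [∀ k, IsSeparated (A k).hom]
    (f : ∀ k, (baseChangeHom τ).obj (S.M.obj (Kt k)) ⟶ A k)
    (hf : letI := τ.toAlgebra
      ∀ (k : ℕ) (v : Fin 2 → ℂ) (hv : v ∈ negCone (Jstar.map τ))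
        (a : ↥(finAdelic (↥(maximalRealSubfield L)) L (IsCMField.complexConj L) 2 Jstar))
        (v' : Fin 2 → ℂ) (hv' : v' ∈ negCone (Jstar.map τ))
        (a' : ↥(finAdelic (↥(maximalRealSubfield L)) L (IsCMField.complexConj L) 2 Jstar)),
        AlgPoints.map (f k) (AlgPoints.baseChangeEquiv τ (S.M.obj (Kt k))
            ((S.pts (Kt k)).symm (ShimuraSetGS.mk L Jstar τ (Kt k).1.1 v hv a))) =
          AlgPoints.map (f k) (AlgPoints.baseChangeEquiv τ (S.M.obj (Kt k))
            ((S.pts (Kt k)).symm (ShimuraSetGS.mk L Jstar τ (Kt k).1.1 v' hv' a'))) ↔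
        SiegelShimuraSet.mk δ (principalLevelSubgroup δ (N₀ * (k + 1).factorial)) ⟨J v, hJ v hv⟩ (b a) =
          SiegelShimuraSet.mk δ (principalLevelSubgroup δ (N₀ * (k + 1).factorial)) ⟨J v', hJ v' hv'⟩ (b a')) :
    ∃ k₀ : ℕ, ∀ k, k₀ ≤ k →
      Function.Injective (AlgPoints.map (L := ℂ) (f k)) ∧
      (∀ (v v' : Fin 2 → ℂ) (hv : v ∈ negCone (Jstar.map τ)) (hv' : v' ∈ negCone (Jstar.map τ))
        (a a' : ↥(finAdelic (↥(maximalRealSubfield L)) L (IsCMField.complexConj L) 2 Jstar)),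
        SiegelShimuraSet.mk δ (principalLevelSubgroup δ (N₀ * (k + 1).factorial)) ⟨J v, hJ v hv⟩ (b a) =
            SiegelShimuraSet.mk δ (principalLevelSubgroup δ (N₀ * (k + 1).factorial)) ⟨J v', hJ v' hv'⟩ (b a') →
          ShimuraSetGS.mk L Jstar τ (Kt k).1.1 v hv a = ShimuraSetGS.mk L Jstar τ (Kt k).1.1 v' hv' a') ∧
      (∀ (v v' : Fin 2 → ℂ) (hv : v ∈ negCone (Jstar.map τ)) (hv' : v' ∈ negCone (Jstar.map τ))
        (a a' : ↥(finAdelic (↥(maximalRealSubfield L)) L (IsCMField.complexConj L) 2 Jstar)),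
        SiegelShimuraSet.mk δ (principalLevelSubgroup δ (N₀ * (k + 1).factorial)) ⟨J v, hJ v hv⟩ (b a) =
            SiegelShimuraSet.mk δ (principalLevelSubgroup δ (N₀ * (k + 1).factorial)) ⟨J v', hJ v' hv'⟩ (b a') →
          ShimuraSetGS.mk L Jstar τ K.1.1 v hv a = ShimuraSetGS.mk L Jstar τ K.1.1 v' hv' a') := by
  letI : Algebra L ℂ := τ.toAlgebra
  classical
  have hN₀0 : N₀ ≠ 0 := by omega
  -- the levels of the tower
  have hKle' : ∀ k, (Kt k).1.1 ≤ K.1.1 := fun k => by rw [hKt k]; exact inf_le_left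
  have hKle : ∀ k, Kt k ≤ K := fun k => show (Kt k).1.1 ≤ K.1.1 from hKle' k
  have hdvd : ∀ {k k' : ℕ}, k ≤ k' → N₀ * (k + 1).factorial ∣ N₀ * (k' + 1).factorial := fun hkk' =>
    mul_dvd_mul_left N₀ (Nat.factorial_dvd_factorial (Nat.succ_le_succ hkk'))
  -- the tower of schemes `T = (S.M K)_ℂ`, `S_k = (S.M K_k)_ℂ`, `π_k = (S.M.map _)_ℂ`: projective sources and base
  have hTproj : IsProjectiveOver ((baseChangeHom τ).obj (S.M.obj K)) := IsProjectiveOver.baseChangeHom_obj τ (S.projective K)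
  have hSproj : ∀ k, IsProjectiveOver ((baseChangeHom τ).obj (S.M.obj (Kt k))) := fun k =>
    IsProjectiveOver.baseChangeHom_obj τ (S.projective (Kt k))
  obtain ⟨π, hπ⟩ : ∃ π : ∀ k, (baseChangeHom τ).obj (S.M.obj (Kt k)) ⟶ (baseChangeHom τ).obj (S.M.obj K),
      ∀ k, π k = (baseChangeHom τ).map (S.M.map (homOfLE (hKle k))) := ⟨_, fun _ => rfl⟩
  -- POINT PRESENTATIONS, then made OPAQUE: `ptT v a = [v, aK]`, `pt k v a = [v, aK_k]` read on the base-changed schemes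
  have hπpt : ∀ (k : ℕ) (v : Fin 2 → ℂ) (hv : v ∈ negCone (Jstar.map τ))
      (a : ↥(finAdelic (↥(maximalRealSubfield L)) L (IsCMField.complexConj L) 2 Jstar)),
      AlgPoints.map (π k) (AlgPoints.baseChangeEquiv τ (S.M.obj (Kt k))
          ((S.pts (Kt k)).symm (ShimuraSetGS.mk L Jstar τ (Kt k).1.1 v hv a))) =
        AlgPoints.baseChangeEquiv τ (S.M.obj K) ((S.pts K).symm (ShimuraSetGS.mk L Jstar τ K.1.1 v hv a)) := by
    intro k v hv a
    rw [hπ, map_baseChangeHom_map_baseChangeEquiv, S.map_pts_symm (homOfLE (hKle k)) v hv a]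
  have hinjT : ∀ {x y : ShimuraSetGS L Jstar τ K.1.1},
      AlgPoints.baseChangeEquiv τ (S.M.obj K) ((S.pts K).symm x) = AlgPoints.baseChangeEquiv τ (S.M.obj K) ((S.pts K).symm y) →
        x = y := fun h => (S.pts K).symm.injective ((AlgPoints.baseChangeEquiv τ (S.M.obj K)).injective h)
  obtain ⟨ptT, pt, hptT, hinj, hptTwd, hpt, hptwd, hptπ, hptf⟩ :
      ∃ (ptT : ∀ (v : Fin 2 → ℂ) (_ : v ∈ negCone (Jstar.map τ))
          (_ : ↥(finAdelic (↥(maximalRealSubfield L)) L (IsCMField.complexConj L) 2 Jstar)),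
          ComplexPoints ((baseChangeHom τ).obj (S.M.obj K)))
        (pt : ∀ (k : ℕ) (v : Fin 2 → ℂ) (_ : v ∈ negCone (Jstar.map τ))
          (_ : ↥(finAdelic (↥(maximalRealSubfield L)) L (IsCMField.complexConj L) 2 Jstar)),
          ComplexPoints ((baseChangeHom τ).obj (S.M.obj (Kt k)))),
        (∀ P : ComplexPoints ((baseChangeHom τ).obj (S.M.obj K)),
          ∃ (v : Fin 2 → ℂ) (hv : v ∈ negCone (Jstar.map τ))
            (a : ↥(finAdelic (↥(maximalRealSubfield L)) L (IsCMField.complexConj L) 2 Jstar)), P = ptT v hv a) ∧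
        (∀ {v v' : Fin 2 → ℂ} {hv : v ∈ negCone (Jstar.map τ)} {hv' : v' ∈ negCone (Jstar.map τ)}
          {a a' : ↥(finAdelic (↥(maximalRealSubfield L)) L (IsCMField.complexConj L) 2 Jstar)},
          ptT v hv a = ptT v' hv' a' → ShimuraSetGS.mk L Jstar τ K.1.1 v hv a = ShimuraSetGS.mk L Jstar τ K.1.1 v' hv' a') ∧
        (∀ {v v' : Fin 2 → ℂ} {hv : v ∈ negCone (Jstar.map τ)} {hv' : v' ∈ negCone (Jstar.map τ)}
          {a a' : ↥(finAdelic (↥(maximalRealSubfield L)) L (IsCMField.complexConj L) 2 Jstar)},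
          ShimuraSetGS.mk L Jstar τ K.1.1 v hv a = ShimuraSetGS.mk L Jstar τ K.1.1 v' hv' a' → ptT v hv a = ptT v' hv' a') ∧
        (∀ (k : ℕ) (P : ComplexPoints ((baseChangeHom τ).obj (S.M.obj (Kt k)))),
          ∃ (v : Fin 2 → ℂ) (hv : v ∈ negCone (Jstar.map τ))
            (a : ↥(finAdelic (↥(maximalRealSubfield L)) L (IsCMField.complexConj L) 2 Jstar)), P = pt k v hv a) ∧
        (∀ (k : ℕ) {v v' : Fin 2 → ℂ} {hv : v ∈ negCone (Jstar.map τ)} {hv' : v' ∈ negCone (Jstar.map τ)}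
          {a a' : ↥(finAdelic (↥(maximalRealSubfield L)) L (IsCMField.complexConj L) 2 Jstar)},
          ShimuraSetGS.mk L Jstar τ (Kt k).1.1 v hv a = ShimuraSetGS.mk L Jstar τ (Kt k).1.1 v' hv' a' → pt k v hv a = pt k v' hv' a') ∧
        (∀ (k : ℕ) (v : Fin 2 → ℂ) (hv : v ∈ negCone (Jstar.map τ))
          (a : ↥(finAdelic (↥(maximalRealSubfield L)) L (IsCMField.complexConj L) 2 Jstar)),
          AlgPoints.map (π k) (pt k v hv a) = ptT v hv a) ∧
        (∀ (k : ℕ) (v : Fin 2 → ℂ) (hv : v ∈ negCone (Jstar.map τ))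
          (a : ↥(finAdelic (↥(maximalRealSubfield L)) L (IsCMField.complexConj L) 2 Jstar))
          (v' : Fin 2 → ℂ) (hv' : v' ∈ negCone (Jstar.map τ))
          (a' : ↥(finAdelic (↥(maximalRealSubfield L)) L (IsCMField.complexConj L) 2 Jstar)),
          AlgPoints.map (f k) (pt k v hv a) = AlgPoints.map (f k) (pt k v' hv' a') ↔
            SiegelShimuraSet.mk δ (principalLevelSubgroup δ (N₀ * (k + 1).factorial)) ⟨J v, hJ v hv⟩ (b a) =
              SiegelShimuraSet.mk δ (principalLevelSubgroup δ (N₀ * (k + 1).factorial)) ⟨J v', hJ v' hv'⟩ (b a')) :=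
    ⟨_, _, S.exists_eq_baseChangeEquiv_pts_symm_mk K, fun h => hinjT h,
      fun h => congrArg (fun x => AlgPoints.baseChangeEquiv τ (S.M.obj K) ((S.pts K).symm x)) h,
      fun k P => S.exists_eq_baseChangeEquiv_pts_symm_mk (Kt k) P,
      fun k _ _ _ _ _ _ h => congrArg (fun x => AlgPoints.baseChangeEquiv τ (S.M.obj (Kt k)) ((S.pts (Kt k)).symm x)) h, hπpt, hf⟩
  clear hπpt hinjT hπ
  -- §a the image relations are antitone (Siegel level change along the tower)
  have hanti : Antitone fun k => {PQ : ComplexPoints ((baseChangeHom τ).obj (S.M.obj K)) ×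
      ComplexPoints ((baseChangeHom τ).obj (S.M.obj K)) |
      ∃ P Q : ComplexPoints ((baseChangeHom τ).obj (S.M.obj (Kt k))),
        AlgPoints.map (π k) P = PQ.1 ∧ AlgPoints.map (π k) Q = PQ.2 ∧ AlgPoints.map (f k) P = AlgPoints.map (f k) Q} := by
    intro k k' hkk' PQ hPQ
    obtain ⟨P', Q', hP', hQ', hf'⟩ := hPQ
    obtain ⟨v, hv, a, rfl⟩ := hpt k' P'
    obtain ⟨v', hv', a', rfl⟩ := hpt k' Q'
    rw [hptf] at hf'
    have hfk := SiegelShimuraSet.mk_eq_mk_of_le δ (principalLevelSubgroup_anti δ (hdvd hkk')) hf'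
    refine ⟨pt k v hv a, pt k v' hv' a', ?_, ?_, (hptf k v hv a v' hv' a').2 hfk⟩
    · rw [← hP', hptπ, hptπ]
    · rw [← hQ', hptπ, hptπ]
  -- §b injectivity at infinite level: `⋂_k R_k ⊆ Δ` (★ FILE B)
  have hinter : (⋂ k, {PQ : ComplexPoints ((baseChangeHom τ).obj (S.M.obj K)) ×
      ComplexPoints ((baseChangeHom τ).obj (S.M.obj K)) |
      ∃ P Q : ComplexPoints ((baseChangeHom τ).obj (S.M.obj (Kt k))),
        AlgPoints.map (π k) P = PQ.1 ∧ AlgPoints.map (π k) Q = PQ.2 ∧ AlgPoints.map (f k) P = AlgPoints.map (f k) Q}) ⊆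
      {PQ | PQ.1 = PQ.2} := by
    intro PQ hPQ
    rw [Set.mem_iInter] at hPQ
    obtain ⟨v, hv, a, h1⟩ := hptT PQ.1
    obtain ⟨v', hv', a', h2⟩ := hptT PQ.2
    show PQ.1 = PQ.2
    rw [h1, h2]
    -- the hypothesis of ★ FILE B, level by level
    have hcore : ∀ k : ℕ, ∃ u ∈ K.1.1,
        SiegelShimuraSet.mk δ (principalLevelSubgroup δ (N₀ * (k + 1).factorial)) ⟨J v, hJ v hv⟩ (b a) =
          SiegelShimuraSet.mk δ (principalLevelSubgroup δ (N₀ * (k + 1).factorial)) ⟨J v', hJ v' hv'⟩ (b a' * b u) := by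
      intro k
      obtain ⟨P, Q, hP, hQ, hfPQ⟩ := hPQ k
      obtain ⟨w, hw, c, rfl⟩ := hpt k P
      obtain ⟨w', hw', c', rfl⟩ := hpt k Q
      rw [hptπ, h1] at hP
      rw [hptπ, h2] at hQ
      -- normalise the lifts: `[w, c]_{K_k} = [v, a u]_{K_k}`, `[w′, c′]_{K_k} = [v′, a′ u′]_{K_k}` with `u, u′ ∈ K`
      obtain ⟨u, hu, hwu⟩ := (ShimuraSetGS.mk_eq_mk_iff_exists_mem L Jstar τ (hKle' k) v w hv hw a c).1 (hinj hP).symm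
      obtain ⟨u', hu', hwu'⟩ := (ShimuraSetGS.mk_eq_mk_iff_exists_mem L Jstar τ (hKle' k) v' w' hv' hw' a' c').1 (hinj hQ).symm
      rw [hptwd k hwu, hptwd k hwu', hptf, map_mul, map_mul] at hfPQ
      -- move `b(u) ∈ K_δ(1)` across
      have hκ1 : b u ∈ principalLevelSubgroup δ 1 := principalLevelSubgroup_anti δ (one_dvd N₀) (hle hu)
      rw [SiegelShimuraSet.mk_mul_eq_mk_iff_of_mem_one _ hκ1] at hfPQ
      refine ⟨u' * u⁻¹, mul_mem hu' (inv_mem hu), ?_⟩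
      rw [map_mul, map_inv, ← mul_assoc]
      exact hfPQ
    exact hptTwd (gs_mk_eq_of_forall_siegel_mk_eq J hJ b bq hJinj hJrat hbrat hbcont hN₀0 K.1.1 hle K.1.2.2 hv hv' hcore)
  -- §c Noetherian image-stationarity: ONE level `k₀` with `R_{k₀} ⊆ Δ`, hence all `k ≥ k₀`
  obtain ⟨k₀, hk₀⟩ := exists_setOf_exists_map_eq_subset_of_iInter_subset hTproj hSproj π f hanti hinter
  refine ⟨k₀, fun k hk => ?_⟩
  -- (iii) separation of `Sh_K` by the level-`N₀(k+1)!` shadow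
  have hsep : ∀ (v v' : Fin 2 → ℂ) (hv : v ∈ negCone (Jstar.map τ)) (hv' : v' ∈ negCone (Jstar.map τ))
      (a a' : ↥(finAdelic (↥(maximalRealSubfield L)) L (IsCMField.complexConj L) 2 Jstar)),
      SiegelShimuraSet.mk δ (principalLevelSubgroup δ (N₀ * (k + 1).factorial)) ⟨J v, hJ v hv⟩ (b a) =
          SiegelShimuraSet.mk δ (principalLevelSubgroup δ (N₀ * (k + 1).factorial)) ⟨J v', hJ v' hv'⟩ (b a') →
        ShimuraSetGS.mk L Jstar τ K.1.1 v hv a = ShimuraSetGS.mk L Jstar τ K.1.1 v' hv' a' := by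
    intro v v' hv hv' a a' hN
    have hR : (AlgPoints.map (π k) (pt k v hv a), AlgPoints.map (π k) (pt k v' hv' a')) ∈
        {PQ : ComplexPoints ((baseChangeHom τ).obj (S.M.obj K)) × ComplexPoints ((baseChangeHom τ).obj (S.M.obj K)) |
          ∃ P Q : ComplexPoints ((baseChangeHom τ).obj (S.M.obj (Kt k))),
            AlgPoints.map (π k) P = PQ.1 ∧ AlgPoints.map (π k) Q = PQ.2 ∧ AlgPoints.map (f k) P = AlgPoints.map (f k) Q} :=
      ⟨_, _, rfl, rfl, (hptf k v hv a v' hv' a').2 hN⟩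
    have hD : AlgPoints.map (π k) (pt k v hv a) = AlgPoints.map (π k) (pt k v' hv' a') := hk₀ (hanti hk hR)
    rw [hptπ, hptπ] at hD
    exact hinj hD
  -- (ii) injectivity in `Sh_{K_k}(ℂ)` by the pair law (★ part (B))
  have hsepk : ∀ (v v' : Fin 2 → ℂ) (hv : v ∈ negCone (Jstar.map τ)) (hv' : v' ∈ negCone (Jstar.map τ))
      (a a' : ↥(finAdelic (↥(maximalRealSubfield L)) L (IsCMField.complexConj L) 2 Jstar)),
      SiegelShimuraSet.mk δ (principalLevelSubgroup δ (N₀ * (k + 1).factorial)) ⟨J v, hJ v hv⟩ (b a) =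
          SiegelShimuraSet.mk δ (principalLevelSubgroup δ (N₀ * (k + 1).factorial)) ⟨J v', hJ v' hv'⟩ (b a') →
        ShimuraSetGS.mk L Jstar τ (Kt k).1.1 v hv a = ShimuraSetGS.mk L Jstar τ (Kt k).1.1 v' hv' a' := by
    intro v v' hv hv' a a' hN
    have hpair := gs_mk_inf_comap_eq_of_gs_mk_eq_of_siegel_mk_eq J hJ b bq hJsmul hb hJrat hN₀ (dvd_mul_right N₀ _) K.1.1 hle
      hv hv' (hsep v v' hv hv' a a' hN) hN
    exact ShimuraSetGS.mk_eq_mk_of_le L Jstar τ (hKt k).ge hpair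
  refine ⟨fun P Q hPQ => ?_, hsepk, hsep⟩
  -- (i) injectivity of `f_k` on complex points
  obtain ⟨v, hv, a, rfl⟩ := hpt k P
  obtain ⟨v', hv', a', rfl⟩ := hpt k Q
  exact hptwd k (hsepk v v' hv hv' a a' ((hptf k v hv a v' hv' a').1 hPQ))

end UnitaryCurve

end Literature.AlgebraicGeometry.ShimuraVarieties

end
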